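import Summits.KontsevichZagierPeriods.KontsevichZagierPeriods.Theorems.SoloBlindFifthRoot
import HarnessLib

/-!
# The principal `N`-th root is `ℚ`-semialgebraic on the closed upper half-plane

`SoloBlindFifthRoot` singled out the principal fifth root by the sector `0 ≤ Im k < Re k`, whose
rational slope `1 = tan(π/4)` happens to separate `π/5` from `2π/5`.  For a general level `N` no
rational slope separates `π/N` from the other roots, so we use a different POLYNOMIAL selector:
for `w ≠ 0` with `Im w ≥ 0` and `N ≥ 2`, the principal root `k = w^{1/N}` (`arg k = arg w / N ∈
[0, π/N]`) is the unique `k` with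

  `k^N = w,   Im (k^m) ≥ 0 for all m ≤ N,   0 < Re k + Im k`.

Indeed `Im (k^m) = ‖k‖^m sin (m · arg k)`; if `arg k ∈ [0, π)` exceeded `π/N`, the least `m ≤ N`
with `m · arg k > π` would have `m · arg k < 2π`, hence `Im (k^m) < 0`; and `Re k + Im k > 0`
excludes `arg k = π`.  The real and imaginary parts of `(s + it)^m` are integer polynomials in
`(s, t)` (`powRI`), so the graph of `(Re w, Im w) ↦ (Re w^{1/N}, Im w^{1/N})` is the projection of
a `ℚ`-semialgebraic subset of `ℝ⁴`, and Tarski–Seidenberg (`tarski_seidenberg_real_holds`) gives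
`isSemialgebraicFunOn_rootNRe`, `isSemialgebraicFunOn_rootNIm`.  These feed the semialgebraicity
of the two-exponent Cauchy integrands `z^{k/N-1}(1-z)^{l/N-1}` (`SoloBlindCyclic*`).

References: J. Bochnak, M. Coste, M.-F. Roy, *Real algebraic geometry* (1998), Thm 2.2.1,
Prop. 2.2.6; M. Kontsevich, D. Zagier, *Periods* (2001), §1.1.
-/

noncomputable section

namespace Summit.KontsevichZagierPeriods.KontsevichZagierPeriods.Theorems

open Set Complex
open Literature.ModelTheory.ExponentialFields (IsSemialgebraic isSemialgebraic_setOf_eval_pos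
  isSemialgebraic_setOf_eval_eq_zero isSemialgebraic_setOf_eval_nonneg
  isSemialgebraic_setOf_eval_ne_zero tarski_seidenberg_real_holds)
open MvPolynomial (aeval X)
open Literature.NumberTheory.Transcendental

namespace SoloBlind

/-! ## The principal `N`-th root and its polynomial selector -/

/-- The principal `N`-th root `w^{1/N}`. -/
def rootN (N : ℕ) (w : ℂ) : ℂ := w ^ ((N : ℂ)⁻¹)

/-- `(w^{1/N})^N = w`. -/
theorem rootN_pow_self {N : ℕ} (hN : N ≠ 0) (w : ℂ) : rootN N w ^ N = w := cpow_nat_inv_pow w hN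

/-- `(w^{1/N})^m = w^{m/N}`. -/
theorem rootN_pow_eq (N m : ℕ) (w : ℂ) : rootN N w ^ m = w ^ (((m : ℝ) / N : ℝ) : ℂ) := by
  rw [rootN, ← cpow_nat_mul]
  congr 1
  push_cast
  ring

/-- Polar form of the imaginary part of a natural power. -/
theorem pow_im_eq_norm_pow_mul_sin (k : ℂ) (m : ℕ) :
    (k ^ m).im = ‖k‖ ^ m * Real.sin (m * arg k) := by
  have e : k ^ m = ((‖k‖ ^ m : ℝ) : ℂ) * exp (((m * arg k : ℝ) : ℂ) * I) := by
    conv_lhs => rw [← norm_mul_exp_arg_mul_I k]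
    rw [mul_pow, ← Complex.exp_nat_mul]
    push_cast
    ring_nf
  rw [e, im_ofReal_mul, exp_ofReal_mul_I_im]

/-- The selector conditions force `0 ≤ arg k` and `N · arg k ≤ π`. -/
theorem arg_bounds_of_selector {N : ℕ} {k : ℂ} (hk : k ≠ 0)
    (him : ∀ m, m ≤ N → 0 ≤ (k ^ m).im) (hpos : 0 < k.re + k.im) (hN : 1 ≤ N) :
    0 ≤ arg k ∧ (N : ℝ) * arg k ≤ Real.pi := by
  have h1 : 0 ≤ k.im := by simpa using him 1 hN
  have hθ0 : 0 ≤ arg k := arg_nonneg_iff.mpr h1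
  have hθπ : arg k < Real.pi := by
    rcases (arg_le_pi k).lt_or_eq with h | h
    · exact h
    · exfalso
      rw [arg_eq_pi_iff] at h
      linarith [h.1, h.2]
  refine ⟨hθ0, ?_⟩
  have key : ∀ m, m ≤ N → (m : ℝ) * arg k ≤ Real.pi := by
    intro m
    induction m with
    | zero => intro; simpa using Real.pi_pos.le
    | succ m ih =>
      intro hm
      have h' := ih (by omega)
      by_contra hlt
      push Not at hlt
      have hsin : Real.sin (((m + 1 : ℕ) : ℝ) * arg k) < 0 := by
        have h2 : ((m + 1 : ℕ) : ℝ) * arg k - Real.pi < Real.pi := by push_cast; nlinarith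
        have := Real.sin_pos_of_pos_of_lt_pi (x := ((m + 1 : ℕ) : ℝ) * arg k - Real.pi)
          (by linarith) h2
        rw [Real.sin_sub_pi] at this
        linarith
      have h0 := him (m + 1) hm
      rw [pow_im_eq_norm_pow_mul_sin] at h0
      have hkpos : 0 < ‖k‖ ^ (m + 1) := pow_pos (norm_pos_iff.mpr hk) _
      nlinarith
  exact key N le_rfl

/-- Two nonzero numbers with arguments in `[0, π/N]` and equal `N`-th powers coincide. -/
theorem eq_of_pow_eq_of_arg_bounds {N : ℕ} (hN : N ≠ 0) {k k' : ℂ} (hk : k ≠ 0)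
    (h0 : 0 ≤ arg k) (h1 : (N : ℝ) * arg k ≤ Real.pi) (h0' : 0 ≤ arg k')
    (h1' : (N : ℝ) * arg k' ≤ Real.pi) (h : k ^ N = k' ^ N) : k = k' := by
  have hnorm : ‖k‖ = ‖k'‖ := by
    have h5 : ‖k‖ ^ N = ‖k'‖ ^ N := by rw [← norm_pow, ← norm_pow, h]
    exact (pow_left_inj₀ (norm_nonneg _) (norm_nonneg _) hN).mp h5
  have hexp : exp ((N : ℕ) * (arg k * I)) = exp ((N : ℕ) * (arg k' * I)) := by
    rw [Complex.exp_nat_mul, Complex.exp_nat_mul]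
    have e1 : k ^ N = (‖k‖ : ℂ) ^ N * exp (arg k * I) ^ N := by
      rw [← mul_pow, norm_mul_exp_arg_mul_I]
    have e2 : k' ^ N = (‖k'‖ : ℂ) ^ N * exp (arg k' * I) ^ N := by
      rw [← mul_pow, norm_mul_exp_arg_mul_I]
    have hn0 : (‖k‖ : ℂ) ^ N ≠ 0 := pow_ne_zero _ (ofReal_ne_zero.mpr (norm_ne_zero_iff.mpr hk))
    rw [e1, e2, ← hnorm] at h
    exact mul_left_cancel₀ hn0 h
  obtain ⟨n, hn⟩ := exp_eq_exp_iff_exists_int.mp hexp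
  have hreal : (N : ℝ) * arg k = N * arg k' + n * (2 * Real.pi) := by
    have e1 : ((N : ℕ) : ℂ) * (arg k * I) = ((N * arg k : ℝ) : ℂ) * I := by push_cast; ring
    have e2 : ((N : ℕ) : ℂ) * (arg k' * I) + n * (2 * Real.pi * I) =
        ((N * arg k' + n * (2 * Real.pi) : ℝ) : ℂ) * I := by push_cast; ring
    rw [e1, e2] at hn
    exact_mod_cast mul_right_cancel₀ I_ne_zero hn
  have hpi := Real.pi_pos
  have hNpos : (0 : ℝ) < N := by exact_mod_cast Nat.pos_of_ne_zero hN
  have hn0 : n = 0 := by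
    rcases lt_trichotomy n 0 with hneg | h0 | hpos
    · have : (n : ℝ) ≤ -1 := by exact_mod_cast Int.le_sub_one_iff.mpr hneg
      nlinarith
    · exact h0
    · have : (1 : ℝ) ≤ n := by exact_mod_cast hpos
      nlinarith
  rw [hn0] at hreal
  simp only [Int.cast_zero, zero_mul, add_zero] at hreal
  exact ext_norm_arg hnorm ((mul_right_inj' hNpos.ne').mp hreal)

/-- The principal root satisfies the selector conditions. -/
theorem rootN_selector {N : ℕ} (hN : 2 ≤ N) {w : ℂ} (hw : w ≠ 0) (him : 0 ≤ w.im) :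
    (∀ m, m ≤ N → 0 ≤ (rootN N w ^ m).im) ∧ 0 < (rootN N w).re + (rootN N w).im := by
  have h0 : 0 ≤ arg w := arg_nonneg_iff.mpr him
  have h1 : arg w ≤ Real.pi := arg_le_pi w
  have hpi := Real.pi_pos
  have hNpos : (0 : ℝ) < N := by exact_mod_cast (show 0 < N by omega)
  have hr : ∀ y : ℝ, 0 < ‖w‖ ^ y := fun y => Real.rpow_pos_of_pos (norm_pos_iff.mpr hw) _
  constructor
  · intro m hm
    rw [rootN_pow_eq, cpow_ofReal_im]
    refine mul_nonneg (hr _).le (Real.sin_nonneg_of_nonneg_of_le_pi (by positivity) ?_)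
    have hmN : (m : ℝ) / N ≤ 1 := by
      rw [div_le_one hNpos]
      exact_mod_cast hm
    have : 0 ≤ (m : ℝ) / N := by positivity
    nlinarith
  · have hre : (rootN N w).re = ‖w‖ ^ ((N : ℝ)⁻¹) * Real.cos (arg w * (N : ℝ)⁻¹) := by
      rw [rootN, ← ofReal_natCast, ← ofReal_inv, cpow_ofReal_re]
    have him' : (rootN N w).im = ‖w‖ ^ ((N : ℝ)⁻¹) * Real.sin (arg w * (N : ℝ)⁻¹) := by
      rw [rootN, ← ofReal_natCast, ← ofReal_inv, cpow_ofReal_im]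
    rw [hre, him', ← mul_add]
    refine mul_pos (hr _) ?_
    have hθ0 : 0 ≤ arg w * (N : ℝ)⁻¹ := by positivity
    have hθ1 : arg w * (N : ℝ)⁻¹ ≤ Real.pi / 2 := by
      rw [← div_eq_mul_inv, div_le_div_iff₀ hNpos two_pos]
      have hN' : (2 : ℝ) ≤ N := by exact_mod_cast hN
      nlinarith
    rcases hθ0.eq_or_lt with h | h
    · rw [← h]; simp
    · have hs := Real.sin_pos_of_pos_of_lt_pi h (by linarith)
      have hc := Real.cos_nonneg_of_neg_pi_div_two_le_of_le (by linarith) hθ1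
      linarith

/-- **The polynomial selector of the principal `N`-th root.**  For `w ≠ 0` with `Im w ≥ 0` and
`N ≥ 2`, the principal root is the unique `k` with `k^N = w`, `Im (k^m) ≥ 0` for `m ≤ N` and
`0 < Re k + Im k`. -/
theorem eq_rootN_iff {N : ℕ} (hN : 2 ≤ N) {w k : ℂ} (hw : w ≠ 0) (him : 0 ≤ w.im) :
    k = rootN N w ↔ k ^ N = w ∧ (∀ m, m ≤ N → 0 ≤ (k ^ m).im) ∧ 0 < k.re + k.im := by
  have hN0 : N ≠ 0 := by omega
  constructor
  · rintro rfl
    exact ⟨rootN_pow_self hN0 w, rootN_selector hN hw him⟩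
  · rintro ⟨hpow, hsel, hpos⟩
    have hk : k ≠ 0 := by
      rintro rfl
      exact hw (by rw [← hpow, zero_pow hN0])
    have hk' : rootN N w ≠ 0 := by
      intro h
      exact hw (by rw [← rootN_pow_self hN0 w, h, zero_pow hN0])
    obtain ⟨hsel', hpos'⟩ := rootN_selector hN hw him
    obtain ⟨a0, a1⟩ := arg_bounds_of_selector hk hsel hpos (by omega)
    obtain ⟨b0, b1⟩ := arg_bounds_of_selector hk' hsel' hpos' (by omega)
    exact eq_of_pow_eq_of_arg_bounds hN0 hk a0 a1 b0 b1 (by rw [hpow, rootN_pow_self hN0])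

/-! ## The graph of the `N`-th root as a projection -/

/-- Real and imaginary parts of `(X i + i X j)^m` as polynomials with rational coefficients. -/
def powRI (i j : Fin 4) : ℕ → MvPolynomial (Fin 4) ℚ × MvPolynomial (Fin 4) ℚ
  | 0 => (1, 0)
  | m + 1 => ((powRI i j m).1 * X i - (powRI i j m).2 * X j,
      (powRI i j m).1 * X j + (powRI i j m).2 * X i)

/-- `powRI` evaluates to the real and imaginary parts of `(x i + i x j)^m`. -/
theorem aeval_powRI (i j : Fin 4) (x : Fin 4 → ℝ) : ∀ m : ℕ,
    aeval x (powRI i j m).1 = (((x i : ℂ) + x j * I) ^ m).re ∧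
      aeval x (powRI i j m).2 = (((x i : ℂ) + x j * I) ^ m).im
  | 0 => by simp [powRI]
  | m + 1 => by
    obtain ⟨h1, h2⟩ := aeval_powRI i j x m
    simp only [powRI, map_sub, map_add, map_mul, MvPolynomial.aeval_X, h1, h2, pow_succ, mul_re,
      mul_im, add_re, add_im, ofReal_re, ofReal_im, I_re, I_im]
    constructor <;> ring

/-- `Re w^{1/N}` as a function of `(Re w, Im w)`. -/
def rootNRe (N : ℕ) (q : Fin 2 → ℝ) : ℝ := (rootN N ((q 0 : ℂ) + q 1 * I)).re

/-- `Im w^{1/N}` as a function of `(Re w, Im w)`. -/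
def rootNIm (N : ℕ) (q : Fin 2 → ℝ) : ℝ := (rootN N ((q 0 : ℂ) + q 1 * I)).im

/-- The selector set in `ℝ⁴`: `(x 0, x 1) ∈ upper0` and `x i + i x j` satisfies the selector
conditions for `w = x 0 + i x 1`. -/
def rootNSelSet (N : ℕ) (i j : Fin 4) : Set (Fin 4 → ℝ) :=
  {x | ((x i : ℂ) + x j * I) ^ N = (x 0 : ℂ) + x 1 * I ∧
    (∀ m, m ≤ N → 0 ≤ ((((x i : ℂ) + x j * I) ^ m)).im) ∧ 0 < x i + x j ∧
      (0 ≤ x 1 ∧ (0 < x 1 ∨ x 0 ≠ 0))}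

/-- Membership in the selector set says: `(x 0, x 1) ∈ upper0` and `x i + i x j` is the root. -/
theorem mem_rootNSelSet_iff {N : ℕ} (hN : 2 ≤ N) {i j : Fin 4} {x : Fin 4 → ℝ} :
    x ∈ rootNSelSet N i j ↔
      (0 ≤ x 1 ∧ (0 < x 1 ∨ x 0 ≠ 0)) ∧ (x i : ℂ) + x j * I = rootN N ((x 0 : ℂ) + x 1 * I) := by
  constructor
  · rintro ⟨hpow, hsel, hpos, hdom⟩
    have hq : (![x 0, x 1] : Fin 2 → ℝ) ∈ upper0 := by simpa [upper0] using hdom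
    obtain ⟨hw, him⟩ := upper0_ne_zero hq
    simp only [Matrix.cons_val_zero, Matrix.cons_val_one] at hw him
    exact ⟨hdom, (eq_rootN_iff hN hw him).mpr ⟨hpow, hsel, by simpa using hpos⟩⟩
  · rintro ⟨hdom, hk⟩
    have hq : (![x 0, x 1] : Fin 2 → ℝ) ∈ upper0 := by simpa [upper0] using hdom
    obtain ⟨hw, him⟩ := upper0_ne_zero hq
    simp only [Matrix.cons_val_zero, Matrix.cons_val_one] at hw him
    obtain ⟨hpow, hsel, hpos⟩ := (eq_rootN_iff hN hw him).mp hk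
    exact ⟨hpow, hsel, by simpa using hpos, hdom⟩

/-- The sign conditions `Im (x i + i x j)^m ≥ 0, m ≤ n` cut out a `ℚ`-semialgebraic set. -/
theorem isSemialgebraic_imConds (i j : Fin 4) : ∀ n : ℕ,
    IsSemialgebraic ℚ {x : Fin 4 → ℝ | ∀ m, m ≤ n → 0 ≤ ((((x i : ℂ) + x j * I) ^ m)).im}
  | 0 => by
    refine (congrArg (IsSemialgebraic (R := ℝ) ℚ) ?_).mpr
      (isSemialgebraic_setOf_eval_nonneg (k := ℚ) (R := ℝ) (0 : MvPolynomial (Fin 4) ℚ))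
    ext x
    simp
  | n + 1 => by
    have ih := isSemialgebraic_imConds i j n
    have e := isSemialgebraic_setOf_eval_nonneg (k := ℚ) (R := ℝ) (powRI i j (n + 1)).2
    refine (congrArg (IsSemialgebraic (R := ℝ) ℚ) ?_).mpr (ih.inter e)
    ext x
    simp only [mem_setOf_eq, mem_inter_iff, (aeval_powRI i j x (n + 1)).2]
    constructor
    · intro h
      exact ⟨fun m hm => h m (by omega), h (n + 1) le_rfl⟩
    · rintro ⟨h, h'⟩ m hm
      rcases Nat.lt_or_ge m (n + 1) with hlt | hge
      · exact h m (by omega)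
      · have : m = n + 1 := by omega
        rw [this]
        exact h'

/-- The selector set is `ℚ`-semialgebraic. -/
theorem isSemialgebraic_rootNSelSet (N : ℕ) (i j : Fin 4) :
    IsSemialgebraic ℚ (rootNSelSet N i j) := by
  have e1 := isSemialgebraic_setOf_eval_eq_zero (k := ℚ) (R := ℝ) ((powRI i j N).1 - X 0)
  have e2 := isSemialgebraic_setOf_eval_eq_zero (k := ℚ) (R := ℝ) ((powRI i j N).2 - X 1)
  have e3 := isSemialgebraic_imConds i j N
  have e4 := isSemialgebraic_setOf_eval_pos (k := ℚ) (R := ℝ) (X i + X j : MvPolynomial (Fin 4) ℚ)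
  have e6 := isSemialgebraic_setOf_eval_nonneg (k := ℚ) (R := ℝ) (X 1 : MvPolynomial (Fin 4) ℚ)
  have e7 := isSemialgebraic_setOf_eval_pos (k := ℚ) (R := ℝ) (X 1 : MvPolynomial (Fin 4) ℚ)
  have e8 := isSemialgebraic_setOf_eval_ne_zero (k := ℚ) (R := ℝ) (X 0 : MvPolynomial (Fin 4) ℚ)
  refine (congrArg (IsSemialgebraic (R := ℝ) ℚ) ?_).mpr
    (e1.inter (e2.inter (e3.inter (e4.inter (e6.inter (e7.union e8))))))
  ext x
  simp only [rootNSelSet, mem_setOf_eq, mem_inter_iff, mem_union, map_sub, map_add,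
    MvPolynomial.aeval_X, sub_eq_zero, (aeval_powRI i j x N).1, (aeval_powRI i j x N).2,
    Complex.ext_iff, add_re, ofReal_re, mul_re, I_re, mul_zero, ofReal_im, I_im, mul_one,
    sub_self, add_zero, add_im, mul_im, zero_add]
  tauto

/-- **`Re w^{1/N}` is `ℚ`-semialgebraic** on the closed upper half-plane minus the origin. -/
theorem isSemialgebraicFunOn_rootNRe {N : ℕ} (hN : 2 ≤ N) :
    IsSemialgebraicFunOn ℚ upper0 (rootNRe N) := by
  rw [isSemialgebraicFunOn_iff]
  convert tarski_seidenberg_real_holds (isSemialgebraic_rootNSelSet N 2 3) using 1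
  ext v
  simp only [mem_setOf_eq, mem_image]
  have e0 : (Fin.init v : Fin 2 → ℝ) 0 = v 0 := rfl
  have e1 : (Fin.init v : Fin 2 → ℝ) 1 = v 1 := rfl
  have e2 : v (Fin.last 2) = v 2 := rfl
  constructor
  · rintro ⟨hdom, hval⟩
    refine ⟨Fin.snoc v (rootNIm N (Fin.init v)), ?_, by ext i; simp⟩
    have s0 : (Fin.snoc v (rootNIm N (Fin.init v)) : Fin 4 → ℝ) 0 = v 0 := rfl
    have s1 : (Fin.snoc v (rootNIm N (Fin.init v)) : Fin 4 → ℝ) 1 = v 1 := rfl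
    have s2 : (Fin.snoc v (rootNIm N (Fin.init v)) : Fin 4 → ℝ) 2 = v 2 := rfl
    have s3 : (Fin.snoc v (rootNIm N (Fin.init v)) : Fin 4 → ℝ) 3 = rootNIm N (Fin.init v) :=
      Fin.snoc_last (α := fun _ => ℝ) _ v
    rw [mem_rootNSelSet_iff hN, s0, s1, s2, s3]
    refine ⟨by simpa [upper0, e0, e1] using hdom, ?_⟩
    rw [e2] at hval
    apply Complex.ext
    · simpa [rootNRe, e0, e1] using hval
    · simp [rootNIm, e0, e1]
  · rintro ⟨x, hx, rfl⟩
    rw [mem_rootNSelSet_iff hN] at hx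
    obtain ⟨hdom, hk⟩ := hx
    refine ⟨by simpa [upper0, Fin.init] using hdom, ?_⟩
    have := congrArg Complex.re hk
    simpa [rootNRe, Fin.init] using this

/-- **`Im w^{1/N}` is `ℚ`-semialgebraic** on the closed upper half-plane minus the origin. -/
theorem isSemialgebraicFunOn_rootNIm {N : ℕ} (hN : 2 ≤ N) :
    IsSemialgebraicFunOn ℚ upper0 (rootNIm N) := by
  rw [isSemialgebraicFunOn_iff]
  convert tarski_seidenberg_real_holds (isSemialgebraic_rootNSelSet N 3 2) using 1
  ext v
  simp only [mem_setOf_eq, mem_image]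
  have e0 : (Fin.init v : Fin 2 → ℝ) 0 = v 0 := rfl
  have e1 : (Fin.init v : Fin 2 → ℝ) 1 = v 1 := rfl
  have e2 : v (Fin.last 2) = v 2 := rfl
  constructor
  · rintro ⟨hdom, hval⟩
    refine ⟨Fin.snoc v (rootNRe N (Fin.init v)), ?_, by ext i; simp⟩
    have s0 : (Fin.snoc v (rootNRe N (Fin.init v)) : Fin 4 → ℝ) 0 = v 0 := rfl
    have s1 : (Fin.snoc v (rootNRe N (Fin.init v)) : Fin 4 → ℝ) 1 = v 1 := rfl
    have s2 : (Fin.snoc v (rootNRe N (Fin.init v)) : Fin 4 → ℝ) 2 = v 2 := rfl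
    have s3 : (Fin.snoc v (rootNRe N (Fin.init v)) : Fin 4 → ℝ) 3 = rootNRe N (Fin.init v) :=
      Fin.snoc_last (α := fun _ => ℝ) _ v
    rw [mem_rootNSelSet_iff hN, s0, s1, s2, s3]
    refine ⟨by simpa [upper0, e0, e1] using hdom, ?_⟩
    rw [e2] at hval
    apply Complex.ext
    · simp [rootNRe, e0, e1]
    · simpa [rootNIm, e0, e1] using hval
  · rintro ⟨x, hx, rfl⟩
    rw [mem_rootNSelSet_iff hN] at hx
    obtain ⟨hdom, hk⟩ := hx
    refine ⟨by simpa [upper0, Fin.init] using hdom, ?_⟩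
    have := congrArg Complex.im hk
    simpa [rootNIm, Fin.init] using this

end SoloBlind

end Summit.KontsevichZagierPeriods.KontsevichZagierPeriods.Theorems
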